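import Literature.AnabelianGeometry.AbsoluteAnabelian.AbsTopIII.LogObservablePaths
import Literature.AnabelianGeometry.AbsoluteAnabelian.StrictHomotopyFamilies
import HarnessLib

/-!
# [AbsTopIII] Cor. 4.5 (iii), proof: the descent homotopies of `𝔖_log`

Mochizuki, *Topics in Absolute Anabelian Geometry III*, proof of Corollary 4.5 (iii), pp. 109–110
(bib key `MochizukiAbsTopIII2015`; lit key `paper:url-5493eb38cbb7`, kurims manuscript pages).  For
input data `Δ : LogFrobeniusData` of Aut-holomorphic
type — `ι_× = ι : λ^∼ → λ^×` — the homotopy of ONE lowering step `step : 𝒟_[p] → 𝒟_[lower p]`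
(`ι_×` or `ι_log,⋎` whiskered by the prefix functor, identity on bottom paths) and the composite of
`d` steps `descend`, between the STRUCTURAL path functors `pathFunctor'` of `StrictHomotopyFamilies.lean`
(definitionally unfolding; abc-iut-L4-t12), with their transport / additivity rules.  The components
of
`descend` are exactly the homotopies of types (1)–(4) ("`k^×_⋎ → k~_{⋎+n}`, …") of the printed
proof.
-/

namespace Literature.AnabelianGeometry.AbsoluteAnabelian.AbsTopIII

open _root_.CategoryTheory _root_.Quiver LogFrobeniusData

universe u

/-! ### The one-step homotopy along a lowering -/

section Step

variable (Δ : LogFrobeniusData.{u}) (ι : Δ.lamPf ⟶ Δ.lamTimes)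

/-- Step homotopy, innermost layer: `ι_log` whiskered by the prefix (type (1) step).
[cite: MochizukiAbsTopIII2015, Corollary 4.5 (iii) p.109] -/
def stepLog2 (h : LFVertex.nexus ∈ {a : LFVertex | a.row ≤ 2}) (n : ℤ)
    (hn : LFVertex.row1 n ∈ {a : LFVertex | a.row ≤ 2}) {a : V3.{u}} :
    ∀ (x : V3.{u}) (p₂ : Path a x) (e₂ : x ⟶ vRow1.{u} n hn) (e₁ : vRow1.{u} n hn ⟶ vNexus.{u} h),
      (Δ.sub3.pathFunctor' (((p₂.cons e₂).cons e₁).cons (eTimesAt h)) ⟶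
        Δ.sub3.pathFunctor' (lowerLog2 h n hn x p₂ e₂ e₁))
  | .base ⟨.row1 _, _⟩, p₂, _, _ => Functor.whiskerLeft (Δ.sub3.pathFunctor' p₂) Δ.ιlog
  | .base ⟨.nexus, _⟩, _, _, _ => 𝟙 _
  | .base ⟨.third, _⟩, _, _, _ => 𝟙 _
  | .base ⟨.fourth, _⟩, _, _, _ => 𝟙 _
  | .base ⟨.fifth, _⟩, _, _, _ => 𝟙 _
  | .base ⟨.sixth, _⟩, _, _, _ => 𝟙 _
  | .obs, _, _, _ => 𝟙 _

/-- Step homotopy: the layer of the `id`-edge source.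
[cite: MochizukiAbsTopIII2015, Corollary 4.5 (iii) p.109] -/
def stepLog (h : LFVertex.nexus ∈ {a : LFVertex | a.row ≤ 2}) (n : ℤ)
    (hn : LFVertex.row1 n ∈ {a : LFVertex | a.row ≤ 2}) :
    ∀ {a : V3.{u}} (p₁ : Path a (vRow1.{u} n hn)) (e₁ : vRow1.{u} n hn ⟶ vNexus.{u} h),
      (Δ.sub3.pathFunctor' ((p₁.cons e₁).cons (eTimesAt h)) ⟶
        Δ.sub3.pathFunctor' (lowerLog h n hn p₁ e₁))
  | _, .nil, _ => 𝟙 _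
  | _, .cons (b := x) p₂ e₂, e₁ => stepLog2 Δ h n hn x p₂ e₂ e₁

/-- Step homotopy: the layer of the `id`-edge.
[cite: MochizukiAbsTopIII2015, Corollary 4.5 (iii) p.109] -/
def stepId (h : LFVertex.nexus ∈ {a : LFVertex | a.row ≤ 2}) {a : V3.{u}} :
    ∀ (x : V3.{u}) (p₁ : Path a x) (e₁ : x ⟶ vNexus.{u} h),
      (Δ.sub3.pathFunctor' ((p₁.cons e₁).cons (eTimesAt h)) ⟶ Δ.sub3.pathFunctor' (lowerId h x p₁
e₁))
  | .base ⟨.row1 n, hn⟩, p₁, e₁ => stepLog Δ h n hn p₁ e₁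
  | .base ⟨.nexus, _⟩, _, _ => 𝟙 _
  | .base ⟨.third, _⟩, _, _ => 𝟙 _
  | .base ⟨.fourth, _⟩, _, _ => 𝟙 _
  | .base ⟨.fifth, _⟩, _, _ => 𝟙 _
  | .base ⟨.sixth, _⟩, _, _ => 𝟙 _
  | .obs, _, _ => 𝟙 _

/-- Step homotopy when the last edge is `λ^×`.
[cite: MochizukiAbsTopIII2015, Corollary 4.5 (iii) p.109] -/
def stepTimes (h : LFVertex.nexus ∈ {a : LFVertex | a.row ≤ 2}) :
    ∀ {a : V3.{u}} (p : Path a (vNexus.{u} h)),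
      (Δ.sub3.pathFunctor' (p.cons (eTimesAt h)) ⟶ Δ.sub3.pathFunctor' (lowerTimes h p))
  | _, .nil => 𝟙 _
  | _, .cons (b := x) p₁ e₁ => stepId Δ h x p₁ e₁

/-- Step homotopy: the layer of the last edge (`ι_×` whiskered for a final `λ^∼`: type (4) step).
[cite: MochizukiAbsTopIII2015, Corollary 4.5 (iii) p.109] -/
def stepLast {a : V3.{u}} : ∀ (x y : V3.{u}) (p : Path a x) (e : x ⟶ y),
    (Δ.sub3.pathFunctor' (p.cons e) ⟶ Δ.sub3.pathFunctor' (lowerLast x y p e))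
  | .base ⟨.nexus, _⟩, .obs, p, ⟨false⟩ => Functor.whiskerLeft (Δ.sub3.pathFunctor' p) ι
  | .base ⟨.nexus, h⟩, .obs, p, ⟨true⟩ => stepTimes Δ h p
  | .base ⟨.nexus, _⟩, .base _, _, _ => 𝟙 _
  | .base ⟨.row1 _, _⟩, _, _, _ => 𝟙 _
  | .base ⟨.third, _⟩, _, _, _ => 𝟙 _
  | .base ⟨.fourth, _⟩, _, _, _ => 𝟙 _
  | .base ⟨.fifth, _⟩, _, _, _ => 𝟙 _
  | .base ⟨.sixth, _⟩, _, _, _ => 𝟙 _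
  | .obs, _, _, _ => 𝟙 _

/-- **The homotopy of one lowering step** `𝒟_[p] → 𝒟_[lower p]` (structural path functors):
identity, or `ι_×` / `ι_{log}` whiskered by the prefix — the building block of the homotopies of
types (1)–(4) of the proof of Cor. 4.5 (iii).
[cite: MochizukiAbsTopIII2015, Corollary 4.5 (iii) p.109] -/
def step {a : V3.{u}} : ∀ {b : V3.{u}} (p : Path a b),
    (Δ.sub3.pathFunctor' p ⟶ Δ.sub3.pathFunctor' (lower p))
  | _, .nil => 𝟙 _
  | _, .cons (b := x) (c := y) p e => stepLast Δ ι x y p e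

/-- The composite homotopy of `d` lowering steps: `𝒟_[p] → 𝒟_[lower^d p]`.
[cite: MochizukiAbsTopIII2015, Corollary 4.5 (iii) p.109] -/
def descend {a b : V3.{u}} : ∀ (d : ℕ) (p : Path a b),
    (Δ.sub3.pathFunctor' p ⟶ Δ.sub3.pathFunctor' (lower^[d] p))
  | 0, _ => 𝟙 _
  | d + 1, p => step Δ ι p ≫ descend d (lower p)

example (n : ℤ) (x : Δ.X₁) :
    (step Δ ι (logPairLeft.{u} n)).app x = Δ.ιlog.app x := rfl
example (x : Δ.X) :
    (step Δ ι ((Path.nil : Path lvNexus.{u} lvNexus).cons eLamPf)).app x = ι.app x := rfl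

end Step

section Family

variable (Δ : LogFrobeniusData.{u}) (ι : Δ.lamPf ⟶ Δ.lamTimes)

/-- Computation rule. [cite: MochizukiAbsTopIII2015, Corollary 4.5 (iii) p.109] -/
theorem descend_zero {a b : V3.{u}} (p : Path a b) : descend Δ ι 0 p = 𝟙 _ := rfl

/-- Computation rule. [cite: MochizukiAbsTopIII2015, Corollary 4.5 (iii) p.109] -/
theorem descend_succ {a b : V3.{u}} (d : ℕ) (p : Path a b) :
    descend Δ ι (d + 1) p = step Δ ι p ≫ descend Δ ι d (lower p) := rfl

/-- Transport of `descend` along an equality of step counts. [cite: MochizukiAbsTopIII2015,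
Corollary 4.5 (iii) p.109] -/
theorem descend_congr_nat {a b : V3.{u}} {d d' : ℕ} (h : d = d') (p : Path a b) :
    descend Δ ι d p = descend Δ ι d' p ≫ eqToHom (by subst h; rfl) := by
  subst h; simp

/-- Transport of `descend` along an equality of paths. [cite: MochizukiAbsTopIII2015, Corollary 4.5
(iii) p.109] -/
theorem descend_congr {a b : V3.{u}} (d : ℕ) {p₁ p₂ : Path a b} (h : p₁ = p₂) :
    descend Δ ι d p₁ = eqToHom (by rw [h]) ≫ descend Δ ι d p₂ ≫ eqToHom (by rw [h]) := by
  subst h; simp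

/-- `descend` is additive in the number of steps. [cite: MochizukiAbsTopIII2015, Corollary 4.5 (iii)
p.109] -/
theorem descend_add {a b : V3.{u}} (d₁ d₂ : ℕ) :
    ∀ (p : Path a b), descend Δ ι (d₂ + d₁) p = descend Δ ι d₁ p ≫ descend Δ ι d₂ (lower^[d₁] p) ≫
      eqToHom (congrArg Δ.sub3.pathFunctor' (Function.iterate_add_apply lower d₂ d₁ p).symm) := by
  induction d₁ with
  | zero => intro p; simp [descend_zero]
  | succ d₁ ih =>
    intro p
    show step Δ ι p ≫ descend Δ ι (d₂ + d₁) (lower p) = (step Δ ι p ≫ descend Δ ι d₁ (lower p)) ≫ _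
    rw [ih (lower p), Category.assoc]
    rfl
end Family

end Literature.AnabelianGeometry.AbsoluteAnabelian.AbsTopIII
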